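import Summits.BirchSwinnertonDyer.BirchSwinnertonDyer.Theses.ResidualThetaTransportAtTwo
import Summits.BirchSwinnertonDyer.BirchSwinnertonDyer.Theorems.ResidualThetaTransportAtTwoResidualThetaMainConjectureAtTwoAnalyticLayerLawKAtTwo
import HarnessLib

/-!
# STUB-IDEAS `stub_cmLambdaLower` (S2 = RSL_g 22608 BY NAME), ideator k = 4, gen 5 — typed sketch

Family 3 (assume the opposite): a counterexample to S2 is a tuple `(W, g, ι, Ω, κ, γ, S₀, L⁺, L⁻, d, n, ρ, Θ, ϖ)`.
The three plans localise it:

* Plan A (class rigidity / WLOG the minimal partner): the DEMAND exponent `d_g + Σ_g(S₀)` does not depend on the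
  CM partner `g` of `W` — `demandExponent_eq_of_thetaLayerLambdaCongruenceAtTwo`, PROVED here from the route's own
  item Kan⁺ (`ThetaLayerLambdaCongruenceAtTwo`, hypothesis) and the LANDED g-side analytic layer law
  `ResidualThetaLayer.stub_analyticLayerLawKAtTwo`; the SUPPLY is `g`-free by the landed transport count; the
  f-th-root arithmetic moving S2 between partners is `wlogPartner_arith` (PROVED).
* Plan B (anatomy of the minimal member): `indicator_dvd_level_eq_zero_of_cuspCoeff_eq_zero` (PROVED: the typed
  `ℓ ∣ M` branch of `Σ_g` is dead code once `a_ℓ(g) = 0`), `cuspCoeff_eq_zero_of_dvd_level_of_isCMForm` (SIGNATURE,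
  Atkin–Lehner + Serre–Tate), `one_le_normLambdaIndex_of_coeff_zero_eq_zero` (PROVED: `L⁻(0) = 0 ⇒ d ≥ 1`),
  `coeff_zero_Lm_eq_neg_of_isPollackPairK` (the `n = 0` Pollack congruence pins `L⁻(0)`).
* Plan C (extremal `S₀`): `oneCocycle_eq_coboundary_of_odd_card` (PROVED: `H¹(odd group, 2-group) = 0`, the
  pro-odd unramified quotient of `ℚ_{∞,w}`), `downwardHeredity_arith` (PROVED: cancel the tight local room).

BSD is NOT proved by any of this; 26074 and 22608 stay OPEN; nothing here is proposed to `Theorems/`.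
-/

set_option linter.dupNamespace false
set_option autoImplicit false

noncomputable section

open scoped Classical

open Polynomial NumberField IsDedekindDomain Literature.NumberTheory.EllipticCurves
  Literature.NumberTheory.EllipticCurves.ModularForms Literature.NumberTheory.EllipticCurves.GreenbergVatsal2000
  Literature.NumberTheory.IwasawaTheory Rat.HeightOneSpectrum

namespace Summit.BirchSwinnertonDyer.BirchSwinnertonDyer.Cruxes.ResidualThetaCountLowerPureAtTwo.SideaK4G5

/-! ## Plan A — residual-class rigidity: the demand exponent of S2 is partner-free (given Kan⁺) -/

/-- **H-A1 (PROVED modulo the route item Kan⁺ as a hypothesis).** For ONE habitat curve `W`, ONE admissible odd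
`S₀` and TWO CM θ-partners `(g, ι, Ω)`, `(g', ι', Ω')` of `W` (levels `M`, `M'` with their primes in `S₀`), with
Pollack pairs whose minus branches have norm-λ-indices `d`, `d'`: `d + Σ_g(S₀) = d' + Σ_{g'}(S₀)`.
Proof: Kan⁺ twice (both equal the W-side layer λ for large even `n`) and the landed g-side analytic layer law
`stub_analyticLayerLawKAtTwo` twice; subtract `(2ⁿ−1)/3`. -/
theorem demandExponent_eq_of_thetaLayerLambdaCongruenceAtTwo
    (hKan : Summit.BirchSwinnertonDyer.BirchSwinnertonDyer.Theses.ResidualThetaTransportAtTwo.ThetaLayerLambdaCongruenceAtTwo)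
    (W : WeierstrassCurve ℚ) [W.IsElliptic] [W.IsGloballyMinimal] (hcm : ¬ W.HasCM) (hr : W.analyticRank = 0)
    (hss : Literature.NumberTheory.EllipticCurves.Rank1Residual.GoodSS W 2) (ha2 : W.frobeniusTrace 2 = 0)
    (hΔ : W.Δ < 0) [NeZero (W.conductorNorm ℤ)]
    (f : CuspForm (CongruenceSubgroup.Gamma0 (W.conductorNorm ℤ)) 2) (hf : IsNewformOf W f)
    (S₀ : Finset (HeightOneSpectrum (RingOfIntegers ℚ)))
    (hS2 : ∀ v ∈ S₀, ((2 : ℕ) : RingOfIntegers ℚ) ∉ v.asIdeal)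
    (hSbad : ∀ v : HeightOneSpectrum (RingOfIntegers ℚ), ¬ W.HasGoodReductionAt v → v ∈ S₀)
    -- partner no. 1
    (M : ℕ) [NeZero M] (g : CuspForm (CongruenceSubgroup.Gamma0 M) 2) (ι : coeffField g →+* PadicAlgCl 2)
    (Ω : ℂ) (hM : Odd M) (hg : IsNewform0 g)
    (hgcm : Literature.NumberTheory.Automorphic.IsCMForm (liftToGamma1 M 2 g)) (hga2 : cuspCoeff g 2 = 0)
    (hΩ : IsPlusPeriod g Ω)
    (hcong : ∀ ℓ : ℕ, ℓ.Prime → ¬ ℓ ∣ 2 * M * W.conductorNorm ℤ →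
      ‖embCoeff g ι ℓ - (W.frobeniusTrace ℓ : PadicAlgCl 2)‖ < 1)
    (hSM : ∀ v : HeightOneSpectrum (RingOfIntegers ℚ), natGenerator v ∣ M → v ∈ S₀)
    (Lp Lm : IwasawaAlgebraO (Set.range ι)) (d : ℕ) (hP : IsPollackPairK g ι Ω Lp Lm)
    (hdom : ∀ k : ℕ, ‖PowerSeries.coeff k (iwasawaOToPowerSeries (Set.range ι) Lm)‖ ≤
      ‖PowerSeries.coeff d (iwasawaOToPowerSeries (Set.range ι) Lm)‖)
    (hmin : ∀ k : ℕ, k < d → ‖PowerSeries.coeff k (iwasawaOToPowerSeries (Set.range ι) Lm)‖ <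
      ‖PowerSeries.coeff d (iwasawaOToPowerSeries (Set.range ι) Lm)‖)
    -- partner no. 2
    (M' : ℕ) [NeZero M'] (g' : CuspForm (CongruenceSubgroup.Gamma0 M') 2) (ι' : coeffField g' →+* PadicAlgCl 2)
    (Ω' : ℂ) (hM' : Odd M') (hg' : IsNewform0 g')
    (hgcm' : Literature.NumberTheory.Automorphic.IsCMForm (liftToGamma1 M' 2 g')) (hga2' : cuspCoeff g' 2 = 0)
    (hΩ' : IsPlusPeriod g' Ω')
    (hcong' : ∀ ℓ : ℕ, ℓ.Prime → ¬ ℓ ∣ 2 * M' * W.conductorNorm ℤ →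
      ‖embCoeff g' ι' ℓ - (W.frobeniusTrace ℓ : PadicAlgCl 2)‖ < 1)
    (hSM' : ∀ v : HeightOneSpectrum (RingOfIntegers ℚ), natGenerator v ∣ M' → v ∈ S₀)
    (Lp' Lm' : IwasawaAlgebraO (Set.range ι')) (d' : ℕ) (hP' : IsPollackPairK g' ι' Ω' Lp' Lm')
    (hdom' : ∀ k : ℕ, ‖PowerSeries.coeff k (iwasawaOToPowerSeries (Set.range ι') Lm')‖ ≤
      ‖PowerSeries.coeff d' (iwasawaOToPowerSeries (Set.range ι') Lm')‖)
    (hmin' : ∀ k : ℕ, k < d' → ‖PowerSeries.coeff k (iwasawaOToPowerSeries (Set.range ι') Lm')‖ <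
      ‖PowerSeries.coeff d' (iwasawaOToPowerSeries (Set.range ι') Lm')‖) :
    d + (∑ v ∈ S₀, 2 ^ padicValNat 2 ((natGenerator v ^ 2 - 1) / 8) *
        (if natGenerator v ∣ M then (if ‖embCoeff g ι (natGenerator v) - 1‖ < 1 then 1 else 0)
          else (if ‖embCoeff g ι (natGenerator v)‖ < 1 then 2 else 0))) =
    d' + (∑ v ∈ S₀, 2 ^ padicValNat 2 ((natGenerator v ^ 2 - 1) / 8) *
        (if natGenerator v ∣ M' then (if ‖embCoeff g' ι' (natGenerator v) - 1‖ < 1 then 1 else 0)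
          else (if ‖embCoeff g' ι' (natGenerator v)‖ < 1 then 2 else 0))) := by
  obtain ⟨n₀, hn₀⟩ := hKan W hcm hr hss ha2 hΔ M g ι Ω hM hg hgcm hga2 hΩ hcong f hf S₀ hS2 hSbad hSM
  obtain ⟨n₀', hn₀'⟩ := hKan W hcm hr hss ha2 hΔ M' g' ι' Ω' hM' hg' hgcm' hga2' hΩ' hcong' f hf S₀ hS2 hSbad hSM'
  obtain ⟨n₁, hn₁⟩ :=
    Summit.BirchSwinnertonDyer.BirchSwinnertonDyer.Theorems.ResidualThetaLayer.stub_analyticLayerLawKAtTwo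
      M g ι Ω hg Lp Lm d hP hdom hmin S₀ hS2
  obtain ⟨n₁', hn₁'⟩ :=
    Summit.BirchSwinnertonDyer.BirchSwinnertonDyer.Theorems.ResidualThetaLayer.stub_analyticLayerLawKAtTwo
      M' g' ι' Ω' hg' Lp' Lm' d' hP' hdom' hmin' S₀ hS2
  have hev : Even (2 * (n₀ + n₀' + n₁ + n₁')) := even_two_mul _
  have e1 := hn₀ (2 * (n₀ + n₀' + n₁ + n₁')) (by omega) hev
  have e2 := hn₀' (2 * (n₀ + n₀' + n₁ + n₁')) (by omega) hev
  have e3 := hn₁ (2 * (n₀ + n₀' + n₁ + n₁')) (by omega) hev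
  have e4 := hn₁' (2 * (n₀ + n₀' + n₁ + n₁')) (by omega) hev
  have key := ((e3.symm.trans e1.symm).trans e2).trans e4
  exact Nat.add_right_cancel key

/-- **H-A3 (PROVED modulo Kan⁺; the Emerton–Pollack–Weston identity at supersingular `2` in exponent form).**
The demand exponent of S2 is COMPUTABLE FROM `W` ALONE: `d_g + Σ_g(S₀) = λ(L⁻_W) + Σ_{ℓ∈S₀} 2^{n_ℓ}·d̄_{W,ℓ}`
(`λ(L⁻_W)` = `lam` of the Kobayashi-labelled minus function of `W`'s own Pollack pair up to the period unit,
`d̄_{W,ℓ}` = `matsunoLocalTermAtTwo W ℓ`). Proof: Kan⁺ once, the landed g-side law `stub_analyticLayerLawKAtTwo`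
once, the landed W-side law `stub_analyticLayerLawAtTwo` (stub R2 of crux 20787) once, subtract `(2ⁿ−1)/3`.
Retrodiction (N3): `d(361a1-datum) = λ(L⁻_{19a1}) + 1·[a₁₉(19a1) odd] − 0 = 0 + 1 = 1` = k4-r2's `d = 1`. -/
theorem demandExponent_eq_wSide_of_thetaLayerLambdaCongruenceAtTwo
    (hKan : Summit.BirchSwinnertonDyer.BirchSwinnertonDyer.Theses.ResidualThetaTransportAtTwo.ThetaLayerLambdaCongruenceAtTwo)
    (W : WeierstrassCurve ℚ) [W.IsElliptic] [W.IsGloballyMinimal] (hcm : ¬ W.HasCM) (hr : W.analyticRank = 0)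
    (hss : Literature.NumberTheory.EllipticCurves.Rank1Residual.GoodSS W 2) (ha2 : W.frobeniusTrace 2 = 0)
    (hΔ : W.Δ < 0)
    (M : ℕ) [NeZero M] (g : CuspForm (CongruenceSubgroup.Gamma0 M) 2) (ι : coeffField g →+* PadicAlgCl 2)
    (Ω : ℂ) (hM : Odd M) (hg : IsNewform0 g)
    (hgcm : Literature.NumberTheory.Automorphic.IsCMForm (liftToGamma1 M 2 g)) (hga2 : cuspCoeff g 2 = 0)
    (hΩ : IsPlusPeriod g Ω)
    (hcong : ∀ ℓ : ℕ, ℓ.Prime → ¬ ℓ ∣ 2 * M * W.conductorNorm ℤ →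
      ‖embCoeff g ι ℓ - (W.frobeniusTrace ℓ : PadicAlgCl 2)‖ < 1)
    (κ : ZpExtension ℚ 2) (γ : Field.absoluteGaloisGroup ℚ) (hκ : κ.IsCyclotomic) (hγ : κ.IsTopGenerator γ)
    (hcv : IsCyclotomicVariable 2 γ) [NeZero (W.conductorNorm ℤ)]
    (f : CuspForm (CongruenceSubgroup.Gamma0 (W.conductorNorm ℤ)) 2) (hf : IsNewformOf W f)
    (ϖ : ℚ) (hϖ : (ϖ : ℝ) * W.realPeriodRat = plusPeriod f)
    (Lplus Lminus : IwasawaAlgebra 2)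
    (hPP : Summit.BirchSwinnertonDyer.Rank1Residual.Supersingular.IsPollackPair f 2 Lplus Lminus)
    (S₀ : Finset (HeightOneSpectrum (RingOfIntegers ℚ)))
    (hS2 : ∀ v ∈ S₀, ((2 : ℕ) : RingOfIntegers ℚ) ∉ v.asIdeal)
    (hSbad : ∀ v : HeightOneSpectrum (RingOfIntegers ℚ), ¬ W.HasGoodReductionAt v → v ∈ S₀)
    (hSM : ∀ v : HeightOneSpectrum (RingOfIntegers ℚ), natGenerator v ∣ M → v ∈ S₀)
    (D : Kobayashi2003.SignedSelmerDualData W κ γ 1) [Module.Finite (IwasawaAlgebra 2) D.X]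
    (G : IwasawaAlgebra 2) (m : ℕ)
    (hG : iwasawaToPowerSeries 2 G = PowerSeries.C ((2 : ℚ_[2]) ^ m * (ϖ : ℚ_[2])) *
      iwasawaToPowerSeries 2 (Summit.BirchSwinnertonDyer.Rank1Residual.Supersingular.kobayashiL 1 Lplus Lminus))
    (Lp Lm : IwasawaAlgebraO (Set.range ι)) (d : ℕ) (hP : IsPollackPairK g ι Ω Lp Lm)
    (hdom : ∀ k : ℕ, ‖PowerSeries.coeff k (iwasawaOToPowerSeries (Set.range ι) Lm)‖ ≤
      ‖PowerSeries.coeff d (iwasawaOToPowerSeries (Set.range ι) Lm)‖)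
    (hmin : ∀ k : ℕ, k < d → ‖PowerSeries.coeff k (iwasawaOToPowerSeries (Set.range ι) Lm)‖ <
      ‖PowerSeries.coeff d (iwasawaOToPowerSeries (Set.range ι) Lm)‖) :
    ((d + (∑ v ∈ S₀, 2 ^ padicValNat 2 ((natGenerator v ^ 2 - 1) / 8) *
        (if natGenerator v ∣ M then (if ‖embCoeff g ι (natGenerator v) - 1‖ < 1 then 1 else 0)
          else (if ‖embCoeff g ι (natGenerator v)‖ < 1 then 2 else 0))) : ℕ) : ℤ) =
    ((Summit.BirchSwinnertonDyer.Rank1Residual.X1.MuLambda.lam G : ℕ) : ℤ) +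
      ((∑ v ∈ S₀, 2 ^ padicValNat 2 ((natGenerator v ^ 2 - 1) / 8) *
        matsunoLocalTermAtTwo W (natGenerator v) : ℕ) : ℤ) := by
  obtain ⟨n₀, hn₀⟩ := hKan W hcm hr hss ha2 hΔ M g ι Ω hM hg hgcm hga2 hΩ hcong f hf S₀ hS2 hSbad hSM
  obtain ⟨n₁, hn₁⟩ :=
    Summit.BirchSwinnertonDyer.BirchSwinnertonDyer.Theorems.ResidualThetaLayer.stub_analyticLayerLawKAtTwo
      M g ι Ω hg Lp Lm d hP hdom hmin S₀ hS2
  obtain ⟨n₂, hn₂⟩ :=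
    Summit.BirchSwinnertonDyer.BirchSwinnertonDyer.Theorems.ResidualThetaLayer.stub_analyticLayerLawAtTwo
      W hcm hr hss ha2 hΔ M g ι Ω hM hg hgcm hga2 hΩ hcong κ γ hκ hγ hcv f hf ϖ hϖ Lplus Lminus hPP S₀ hS2
      hSbad hSM D G m hG
  have hev : Even (2 * (n₀ + n₁ + n₂)) := even_two_mul _
  have e1 := hn₀ (2 * (n₀ + n₁ + n₂)) (by omega) hev
  have e3 := hn₁ (2 * (n₀ + n₁ + n₂)) (by omega) hev
  have e5 := hn₂ (2 * (n₀ + n₁ + n₂)) (by omega) hev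
  rw [e1, e3] at e5
  push_cast at e5 ⊢
  omega

/-- **H-A2 (PROVED, arithmetic of the partner swap).** With `q = 2^f`, `q' = 2^{f'}` the residue cardinalities of the
two partners' coefficient rings, the landed transport counts `#𝒮_g[ϖ] = R^f`, `#𝒮_{g'}[ϖ'] = R^{f'}` (`R` = the
W-intrinsic residual plus-Selmer count) and a common demand exponent `D` (H-A1), S2 for one partner is S2 for the
other: `(2^{f'})^D ≤ R^{f'} → (2^f)^D ≤ R^f`. -/
theorem wlogPartner_arith {D f f' R : ℕ} (hf' : f' ≠ 0) (h : (2 ^ f') ^ D ≤ R ^ f') :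
    (2 ^ f) ^ D ≤ R ^ f := by
  rw [← pow_mul, mul_comm, pow_mul] at h ⊢
  exact Nat.pow_le_pow_left ((Nat.pow_le_pow_iff_left hf').mp h) f

/-- The `ℕ∞` form actually met in S2 (`encard`, infinite supply allowed): if the supply set of partner no. 2 is
infinite so is that of partner no. 1 (both have `ncard` a power of the same `R` only when finite), so only the finite
branch needs `wlogPartner_arith`. Recorded as the finite-branch cast. -/
theorem wlogPartner_cast {D f R : ℕ} (S : Set ℕ) (hS : S.Finite) (hcard : S.ncard = R ^ f)
    (h : (2 ^ f) ^ D ≤ R ^ f) : (((2 ^ f) ^ D : ℕ) : ℕ∞) ≤ S.encard := by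
  rw [← hS.cast_ncard_eq, hcard]
  exact_mod_cast h

/-! ## Plan B — anatomy of the minimal member of the class -/

/-- **H-B1 (SIGNATURE; Atkin–Lehner 1970 Thm 3 + Serre–Tate: a CM newform is never Steinberg, so `ℓ ∣ M ⇒ ℓ² ∣ M ⇒
a_ℓ = 0`).** For a CM newform on `Γ₀(M)` (trivial character) every prime dividing the level has Fourier
coefficient `0`. Consequence: the typed `ℓ ∣ M` branch of `Σ_g(S₀)` is identically `0` (next lemma), so the silence
of `hρ` at `ℓ ∣ M` can never produce a counterexample. -/
theorem cuspCoeff_eq_zero_of_dvd_level_of_isCMForm (M : ℕ) [NeZero M]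
    (g : CuspForm (CongruenceSubgroup.Gamma0 M) 2) (hg : IsNewform0 g)
    (hcm : Literature.NumberTheory.Automorphic.IsCMForm (liftToGamma1 M 2 g)) (ℓ : ℕ) (hℓ : ℓ.Prime)
    (hℓM : ℓ ∣ M) : cuspCoeff g ℓ = 0 := by
  sorry

/-- **H-B1' (PROVED).** Once `a_ℓ(g) = 0`, the `ℓ ∣ M` indicator of the typed demand exponent vanishes:
`‖ι(0) − 1‖ = 1 ≮ 1`. -/
theorem indicator_dvd_level_eq_zero_of_cuspCoeff_eq_zero {M : ℕ} (g : CuspForm (CongruenceSubgroup.Gamma0 M) 2)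
    (ι : coeffField g →+* PadicAlgCl 2) {ℓ : ℕ} (hz : cuspCoeff g ℓ = 0) :
    (if ‖embCoeff g ι ℓ - 1‖ < 1 then (1 : ℕ) else 0) = 0 := by
  have h0 : embCoeff g ι ℓ = 0 := by
    have := embCoeff_eq_intCast g ι (n := ℓ) (a := 0) (by simpa using hz)
    simpa using this
  simp [h0]

/-- **H-B2 (PROVED).** If the minus branch vanishes at `T = 0` then its norm-λ-index is `≥ 1` (the analytic-rank-one
member of the class — Gross's `A(p)`, `p ≡ 3 (mod 8)`, root number `−1`, `L'(ψ,1) ≠ 0` by Miller–Yang — has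
`d ≥ 1`). -/
theorem one_le_normLambdaIndex_of_coeff_zero_eq_zero {S : Set (PadicAlgCl 2)} (Lm : IwasawaAlgebraO S)
    (hLm : Lm ≠ 0) (d : ℕ)
    (hdom : ∀ k : ℕ, ‖PowerSeries.coeff k (iwasawaOToPowerSeries S Lm)‖ ≤
      ‖PowerSeries.coeff d (iwasawaOToPowerSeries S Lm)‖)
    (h0 : PowerSeries.coeff 0 (iwasawaOToPowerSeries S Lm) = 0) : 1 ≤ d := by
  by_contra hd
  have hd0 : d = 0 := by omega
  subst hd0
  apply hLm
  apply iwasawaOToPowerSeries_injective S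
  rw [map_zero]
  ext k
  have hk := hdom k
  rw [h0, norm_zero] at hk
  have : PowerSeries.coeff k (iwasawaOToPowerSeries S Lm) = 0 := norm_le_zero_iff.mp hk
  simpa using this

/-- **H-B3 (the `n = 0` Pollack congruence pins the constant term).** `ω₀ = T`, `ω₀⁻ = 1`, sign `(−1)^{0+1}`:
`2^m (θ₀(g)^ι + L⁻) = T·q`, so `L⁻(0) = −θ₀(g)^ι(0)`; hence `L⁻(0) = 0 ⟺ θ₀(g) (0) = 0`, an `L(g,1)/Ω`-multiple
(Mazur–Tate–Teitelbaum §I.8 / Pollack 2003 §2). -/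
theorem coeff_zero_Lm_eq_neg_of_isPollackPairK {M : ℕ} (g : CuspForm (CongruenceSubgroup.Gamma0 M) 2)
    (ι : coeffField g →+* PadicAlgCl 2) (Ω : ℂ) (Lp Lm : IwasawaAlgebraO (Set.range ι))
    (hP : IsPollackPairK g ι Ω Lp Lm) :
    PowerSeries.coeff 0 (iwasawaOToPowerSeries (Set.range ι) Lm) = -((mazurTateElementK g Ω 2 0).map ι).coeff 0 := by
  obtain ⟨m, q, hmq⟩ := hP.2.2.2 0 (by decide)
  have hω : ((cyclotomicOmega 2 0).map (Int.castRingHom (PadicAlgCl 2)) : (PadicAlgCl 2)[X]) = X := by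
    simp [cyclotomicOmega]
  have hsgn : (((-1 : ℤ[X]) ^ (0 / 2 + 1) * cyclotomicOmegaMinus 2 0).map (Int.castRingHom (PadicAlgCl 2)) :
      (PadicAlgCl 2)[X]) = -1 := by
    simp
  rw [hω, hsgn] at hmq
  have h := congrArg (PowerSeries.coeff 0) hmq
  simp only [Polynomial.coe_X, PowerSeries.coeff_zero_X_mul, Polynomial.coe_neg, Polynomial.coe_one, neg_mul,
    one_mul, sub_neg_eq_add, PowerSeries.coeff_C_mul, map_add, Polynomial.coeff_coe] at h
  have h' := (mul_eq_zero.mp h).resolve_left (pow_ne_zero _ (by norm_num))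
  linear_combination h'

/-! ## Plan C — extremal `S₀`: the unramified quotient of `ℚ_{∞,w}` is pro-odd, so local rooms are tight -/

/-- **H-C1 (PROVED).** A finite group of ODD order has no `H¹` on a module killed by `2`: every `1`-cocycle is a
coboundary (with `s = Σ_h c(h)`: `|G|·c(g) = s − g•s`, and `|G|` odd acts as `1`, `−x = x`). Applied to the image of
`Gal(ℚ_{∞,w}^{ur}/ℚ_{∞,w}) ≅ ∏_{q odd} ℤ_q` acting on `A_g[ϖ]^{I_w}` it gives `H¹_ur(ℚ_{∞,w}, A_g[ϖ]) = 0`, so the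
room gained by relaxing S2's Selmer set at an optional odd prime `ℓ` is the whole `⊕_{w∣ℓ} H¹(ℚ_{∞,w}, A_g[ϖ])`, of
order `q^{2^{n_ℓ}·2·[a_ℓ(g) ∈ 𝔪]}` — exactly the typed demand increment. [NSW (1.6.2); Brown, Cohomology of Groups III.10.2] -/
theorem oneCocycle_eq_coboundary_of_odd_card {G A : Type*} [Group G] [Fintype G] [AddCommGroup A]
    [DistribMulAction G A] (hA : ∀ a : A, 2 • a = 0) (hG : Odd (Fintype.card G)) (c : G → A)
    (hc : ∀ g h : G, c (g * h) = c g + g • c h) : ∃ a : A, ∀ g : G, c g = g • a - a := by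
  refine ⟨∑ h, c h, fun g ↦ ?_⟩
  -- reindex the sum along left multiplication by `g`
  have hre : ∑ h, c (g * h) = ∑ h, c h :=
    Fintype.sum_bijective (g * ·) (Group.mulLeft_bijective g) (fun h ↦ c (g * h)) c fun _ ↦ rfl
  have hsum : ∑ h, c (g * h) = Fintype.card G • c g + g • ∑ h, c h := by
    simp only [hc, Finset.sum_add_distrib, Finset.sum_const, Finset.card_univ, Finset.smul_sum]
  -- `|G|` odd acts as the identity on the `2`-torsion group `A`
  have hodd : Fintype.card G • c g = c g := by
    obtain ⟨k, hk⟩ := hG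
    rw [hk, add_smul, one_smul, mul_comm, mul_smul, hA, smul_zero, zero_add]
  have hneg : ∀ x : A, -x = x := fun x ↦ by
    rw [neg_eq_iff_add_eq_zero, ← two_smul ℕ x]
    exact hA x
  rw [hre, hodd] at hsum
  -- `c g = s - g • s = g • s - s`
  have : c g = ∑ h, c h - g • ∑ h, c h := by rw [eq_sub_iff_add_eq]; exact hsum.symm
  rw [this, ← neg_sub, hneg]

/-- **H-C2 (PROVED, the cancellation behind downward heredity).** Demand at `S₀ ∪ {ℓ}` is demand at `S₀` times the
room `q^e`; supply at `S₀ ∪ {ℓ}` is at most supply at `S₀` times the same room (H-C1 + the local count); so S2 at the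
larger set gives S2 at the smaller one. -/
theorem downwardHeredity_arith {q D e B B' : ℕ} (hq : 0 < q) (hS2 : q ^ (D + e) ≤ B') (hroom : B' ≤ B * q ^ e) :
    q ^ D ≤ B := by
  have h : q ^ D * q ^ e ≤ B * q ^ e := by rw [← pow_add]; exact hS2.trans hroom
  exact Nat.le_of_mul_le_mul_right h (pow_pos hq e)

/-- The `ℕ∞`/`encard` form of H-C2 met in S2 (infinite supply at the small set makes S2 there trivial; a finite
supply at the small set with the room bound forces the large set finite too — recorded on the finite branch). -/
theorem downwardHeredity_cast {q D e : ℕ} (S S' : Set ℕ) (hq : 0 < q) (hS : S.Finite) (hS' : S'.Finite)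
    (hS2 : ((q ^ (D + e) : ℕ) : ℕ∞) ≤ S'.encard) (hroom : S'.ncard ≤ S.ncard * q ^ e) :
    ((q ^ D : ℕ) : ℕ∞) ≤ S.encard := by
  rw [← hS'.cast_ncard_eq] at hS2
  rw [← hS.cast_ncard_eq]
  exact_mod_cast downwardHeredity_arith hq (by exact_mod_cast hS2) hroom

end Summit.BirchSwinnertonDyer.BirchSwinnertonDyer.Cruxes.ResidualThetaCountLowerPureAtTwo.SideaK4G5
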